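import Literature.Analysis.ODE.HeunEulerIntegrals
import HarnessLib

/-!
# The derivative-regularised Euler transform `∂_z^k Φ_{θ−k}[v]` solves the target Heun equation
# for `Re θ < k+1`: analytic continuation in the kernel exponent

Topic `Literature/Analysis/ODE` (namespace `Literature.Analysis.ODE`, sub-namespace `GeneralHeun`;
continues `HeunEulerIntegrals.lean`).

Takemura's Proposition 1.2 [Takemura2017] (Kazakov–Slavyanov) states Euler's integral
transformation of Heun's equation with a Pochhammer-type contour, i.e. for ALL kernel exponents;
along the real segment `(1, z)` the integral `Φ_θ[v](z) = ∫₁^z (z−w)^{−θ} v(w) dw` converges only for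
`Re θ < 1` (`HeunEulerIntegrals.heunOperator_eulerΦ`). For `Re θ < k+1` the transform is the
Riemann–Liouville DERIVATIVE `u = ∂_z^k Φ_{θ−k}[v]` (fractional derivative of order `θ−1` of `v`
from the base point `1`, [SamkoKilbasMarichev1993, §2]); this file proves that `u` again solves the
target equation, by analytic continuation in the exponent with the SOURCE FUNCTION `v` FIXED:

* `κ ↦ Ψ_{κ,j}[v](z)` is holomorphic on `{Re κ < 1}` (differentiation under `∫₀¹` in the complex
  parameter, dominated by `|log(1−t)|(1−t)^{−a} t^r`), hence so are the `z`-derivatives of all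
  orders of `Φ_{κ−k}[v]` at a fixed `z`, as functions of `κ` on `{Re κ < k+1}` (`eulerFam`);
* along the affine family of targets `T(κ) = eulerSrc-map(S, 2−κ)` the source operators
  `S(κ) = eulerSrc-map(T(κ), κ)` differ from `S = S(θ)` only in the product `αβ`
  (`eulerSrc`-involution), so for a solution `v` of `M_S v = 0` one has
  `M_{S(κ)} v = c(κ)·w·v(w)` with `c(θ) = 0`; by `heunOperator_eulerΦ` and the recursion
  `∂_z Φ_{κ−1} = (1−κ)Φ_κ`,
  `lead·∂^{k+2}Φ_{κ−k}[v] + mid_{T(κ)}·∂^{k+1}Φ_{κ−k}[v] + low_{T(κ)}·∂^kΦ_{κ−k}[v] = c(κ)·∂^kΦ_{κ−k}[w v]`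
  on `{Re κ < 1}`, and both sides are holomorphic on the half-plane `{Re κ < k+1}`;
* the identity theorem transports the identity to `κ = θ`, where `c(θ) = 0`.

No boundary terms of order `k` are ever computed. Everything here is proved; no named facts.

## References
* K. Takemura, J. Math. Soc. Japan 69 (2017) 849–891, Prop. 1.2. Key `Takemura2017`.
* S. G. Samko, A. A. Kilbas, O. I. Marichev, *Fractional integrals and derivatives*, 1993, §2
  (Riemann–Liouville derivatives `D^μ_{a+} = (d/dx)^k I^{k−μ}_{a+}`). Key `SamkoKilbasMarichev1993`.
-/

noncomputable section

open Set Filter MeasureTheory intervalIntegral Metric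
open scoped Topology Interval

namespace Literature.Analysis.ODE

namespace GeneralHeun

/-! ### Holomorphy of `κ ↦ Ψ_{κ,j}[v](z)` on `{Re κ < 1}` -/

/-- `|log u| ≤ u^{−ε}/ε` for `0 < u ≤ 1`, `ε > 0`. [folklore] -/
private theorem abs_log_le_rpow_neg_div {u ε : ℝ} (hu : 0 < u) (hu1 : u ≤ 1) (hε : 0 < ε) :
    |Real.log u| ≤ u ^ (-ε) / ε := by
  have h := Real.abs_log_mul_self_rpow_lt u ε hu hu1 hε
  have hpos : 0 < u ^ ε := Real.rpow_pos_of_pos hu ε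
  rw [abs_mul, abs_of_pos hpos, lt_div_iff₀ hε] at h
  rw [Real.rpow_neg hu.le, le_div_iff₀ hε]
  have h' : |Real.log u| * ε * u ^ ε ≤ 1 := by nlinarith [h.le]
  calc |Real.log u| * ε = (|Real.log u| * ε * u ^ ε) * (u ^ ε)⁻¹ := by field_simp
    _ ≤ 1 * (u ^ ε)⁻¹ := by gcongr
    _ = (u ^ ε)⁻¹ := one_mul _

/-- The `κ`-derivative of the kernel: `∂_κ k_κ(u) = −log u · k_κ(u)`.
[cite: Takemura2017, Proposition 1.2 (kernel)] -/
theorem hasDerivAt_eulerKernel_kappa (κ : ℂ) (u : ℝ) :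
    HasDerivAt (fun κ' : ℂ => eulerKernel κ' u) (-(Real.log u : ℂ) * eulerKernel κ u) κ := by
  unfold eulerKernel
  have h1 : HasDerivAt (fun κ' : ℂ => -κ' * (Real.log u : ℂ)) (-1 * (Real.log u : ℂ)) κ :=
    (hasDerivAt_id κ).neg.mul_const _
  refine h1.cexp.congr_deriv ?_
  ring

/-- **`κ ↦ Ψ_{κ,j}[v](z)` is complex-differentiable on `{Re κ < 1}`**, with derivative
`∫₀¹ −log(1−t)·(1−t)^{−κ} tʲ v⁽ʲ⁾(1+(z−1)t) dt` (differentiation under the integral sign in the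
complex parameter; majorant `|log(1−t)|(1−t)^{−a} t^r`, `a < 1`).
[cite: SamkoKilbasMarichev1993, §2 (analyticity of `I^α φ` in `α`)] -/
theorem hasDerivAt_eulerΨ_kappa {v : ℝ → ℂ} {b r B : ℝ}
    (hv : ContDiffOn ℝ ((⊤ : ℕ∞) : WithTop ℕ∞) v (Ioo 1 b)) (hbd : EulerBound v r B) (hBb : B ≤ b)
    (hr : -1 < r) {κ₀ : ℂ} (hκ₀ : κ₀.re < 1) (j : ℕ) {z : ℝ} (hz : 1 < z) (hzB : z ≤ B) :
    HasDerivAt (fun κ : ℂ => eulerΨ κ v j z)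
      (∫ t in (0 : ℝ)..1, -(Real.log (1 - t) : ℂ) * eulerΨIntegrand κ₀ v j z t) κ₀ := by
  obtain ⟨C, hC⟩ := hbd j
  set ε₀ : ℝ := (1 - κ₀.re) / 3 with hε₀
  have hε₀pos : 0 < ε₀ := by rw [hε₀]; linarith
  set a : ℝ := κ₀.re + 2 * ε₀ with ha
  have ha1 : a < 1 := by rw [ha, hε₀]; linarith
  have key := intervalIntegral.hasDerivAt_integral_of_dominated_loc_of_deriv_le
    (𝕜 := ℂ) (μ := volume) (a := 0) (b := 1) (F := fun κ t => eulerΨIntegrand κ v j z t)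
    (F' := fun κ t => -(Real.log (1 - t) : ℂ) * eulerΨIntegrand κ v j z t) (x₀ := κ₀)
    (s := ball κ₀ ε₀) (bound := fun t => |C| * (z - 1) ^ (r - (j : ℝ)) / ε₀ * (t ^ r * (1 - t) ^ (-a)))
    (ball_mem_nhds κ₀ hε₀pos) ?_ ?_ ?_ ?_ ?_ ?_
  · exact key.2
  · exact Eventually.of_forall fun κ => aestronglyMeasurable_eulerΨIntegrand hv κ j hz (hzB.trans hBb)
  · exact intervalIntegrable_eulerΨIntegrand hv hbd hBb hr hκ₀ j hz hzB
  · -- measurability of `F' κ₀`: continuity on `(0,1)`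
    have hcont : ContinuousOn (fun t : ℝ => -(Real.log (1 - t) : ℂ) * eulerΨIntegrand κ₀ v j z t)
        (Ioo 0 1) := by
      refine ContinuousOn.mul ?_ (continuousOn_eulerΨIntegrand hv κ₀ j hz (hzB.trans hBb))
      refine (Complex.continuous_ofReal.comp_continuousOn ?_).neg
      refine (Real.continuousOn_log.comp (continuousOn_const.sub continuousOn_id) ?_)
      intro t ht
      exact ne_of_gt (sub_pos.mpr ht.2)
    rw [uIoc_of_le zero_le_one, ← Measure.restrict_congr_set Ioo_ae_eq_Ioc]
    exact hcont.aestronglyMeasurable measurableSet_Ioo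
  · have h1 : ∀ᵐ t : ℝ ∂volume, t ≠ 1 := by
      have : ({1}ᶜ : Set ℝ) ∈ ae volume := by
        rw [compl_mem_ae_iff]; exact measure_singleton 1
      filter_upwards [this] with t ht using ht
    filter_upwards [h1] with t ht1 ht κ hκ
    rw [uIoc_of_le zero_le_one] at ht
    have ht' : t ∈ Ioo (0 : ℝ) 1 := ⟨ht.1, lt_of_le_of_ne ht.2 ht1⟩
    have ht0 : 0 < t := ht'.1
    have hu : 0 < 1 - t := sub_pos.mpr ht'.2
    have hu1 : 1 - t ≤ 1 := by linarith
    -- `Re κ < Re κ₀ + ε₀`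
    have hκre : κ.re ≤ κ₀.re + ε₀ := by
      have h := mem_ball.1 hκ
      rw [dist_eq_norm] at h
      have := Complex.abs_re_le_norm (κ - κ₀)
      rw [Complex.sub_re] at this
      linarith [le_abs_self (κ.re - κ₀.re)]
    have hb := norm_eulerΨIntegrand_le hC κ hz hzB ht'
    rw [norm_mul, norm_neg, Complex.norm_real, Real.norm_eq_abs]
    -- `|log(1−t)| ≤ (1−t)^{−ε₀}/ε₀` and `(1−t)^{−Re κ} ≤ (1−t)^{−(Re κ₀ + ε₀)}`
    have hlog := abs_log_le_rpow_neg_div hu hu1 hε₀pos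
    have hpow : (1 - t) ^ (-κ.re) ≤ (1 - t) ^ (-(κ₀.re + ε₀)) :=
      Real.rpow_le_rpow_of_exponent_ge hu hu1 (by linarith)
    have hprod : |Real.log (1 - t)| * (1 - t) ^ (-κ.re) ≤ (1 - t) ^ (-a) / ε₀ := by
      calc |Real.log (1 - t)| * (1 - t) ^ (-κ.re)
          ≤ ((1 - t) ^ (-ε₀) / ε₀) * (1 - t) ^ (-(κ₀.re + ε₀)) :=
            mul_le_mul hlog hpow (Real.rpow_nonneg hu.le _)
              (div_nonneg (Real.rpow_nonneg hu.le _) hε₀pos.le)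
        _ = (1 - t) ^ (-a) / ε₀ := by
            rw [div_mul_eq_mul_div, ← Real.rpow_add hu, ha]; ring_nf
    have hCz : 0 ≤ |C| * (z - 1) ^ (r - (j : ℝ)) :=
      mul_nonneg (abs_nonneg C) (Real.rpow_nonneg (sub_pos.mpr hz).le _)
    calc |Real.log (1 - t)| * ‖eulerΨIntegrand κ v j z t‖
        ≤ |Real.log (1 - t)| * (C * (z - 1) ^ (r - (j : ℝ)) * (t ^ r * (1 - t) ^ (-κ.re))) :=
          mul_le_mul_of_nonneg_left hb (abs_nonneg _)
      _ ≤ |Real.log (1 - t)| * (|C| * (z - 1) ^ (r - (j : ℝ)) * (t ^ r * (1 - t) ^ (-κ.re))) := by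
          gcongr
          exact le_abs_self C
      _ = |C| * (z - 1) ^ (r - (j : ℝ)) * t ^ r * (|Real.log (1 - t)| * (1 - t) ^ (-κ.re)) := by ring
      _ ≤ |C| * (z - 1) ^ (r - (j : ℝ)) * t ^ r * ((1 - t) ^ (-a) / ε₀) :=
          mul_le_mul_of_nonneg_left hprod (mul_nonneg hCz (Real.rpow_nonneg ht0.le _))
      _ = |C| * (z - 1) ^ (r - (j : ℝ)) / ε₀ * (t ^ r * (1 - t) ^ (-a)) := by ring
  · exact (intervalIntegrable_rpow_mul_one_sub_rpow hr (by linarith : -1 < -a)).const_mul _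
  · refine Eventually.of_forall fun t _ κ _ => ?_
    unfold eulerΨIntegrand
    have h := (hasDerivAt_eulerKernel_kappa κ (1 - t)).mul_const
      ((t : ℂ) ^ j * iteratedDeriv j v (eulerPt z t))
    refine h.congr_deriv ?_
    ring

/-- `κ ↦ Ψ_{κ,j}[v](z)` is holomorphic on the half-plane `{Re κ < 1}`.
[cite: SamkoKilbasMarichev1993, §2 (analyticity of `I^α φ` in `α`)] -/
theorem differentiableOn_eulerΨ_kappa {v : ℝ → ℂ} {b r B : ℝ}
    (hv : ContDiffOn ℝ ((⊤ : ℕ∞) : WithTop ℕ∞) v (Ioo 1 b)) (hbd : EulerBound v r B) (hBb : B ≤ b)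
    (hr : -1 < r) (j : ℕ) {z : ℝ} (hz : 1 < z) (hzB : z ≤ B) :
    DifferentiableOn ℂ (fun κ : ℂ => eulerΨ κ v j z) {κ : ℂ | κ.re < 1} := fun _ hκ =>
  (hasDerivAt_eulerΨ_kappa hv hbd hBb hr hκ j hz hzB).differentiableAt.differentiableWithinAt

/-! ### The derivative family `∂_z^n [k_c(z−1) Ψ_{κ,j}[v](z)]` -/

/-- The family `eulerFam v κ n c j` of functions of `z`, defined by
`eulerFam v κ 0 c j z = k_c(z−1)·Ψ_{κ,j}[v](z)` and
`eulerFam v κ (n+1) c j = −c·eulerFam v κ n (c+1) j + eulerFam v κ n c (j+1)`; it is the `n`-th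
`z`-derivative of `k_c(z−1) Ψ_{κ,j}[v](z)` (`hasDerivAt_eulerFam`), written without binomial sums.
In particular `∂_z^n Φ_κ[v] = eulerFam v κ n (κ−1) 0` (`iteratedDeriv_eulerΦ_eq_eulerFam`).
[cite: SamkoKilbasMarichev1993, §2 (Riemann–Liouville derivatives)] -/
def eulerFam (v : ℝ → ℂ) (κ : ℂ) : ℕ → ℂ → ℕ → ℝ → ℂ
  | 0, c, j, z => eulerKernel c (z - 1) * eulerΨ κ v j z
  | n + 1, c, j, z => -c * eulerFam v κ n (c + 1) j z + eulerFam v κ n c (j + 1) z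

/-- The family is a chain of derivatives in `z` on `(1,B)` (`Re κ < 1`).
[cite: SamkoKilbasMarichev1993, §2 (Riemann–Liouville derivatives)] -/
theorem hasDerivAt_eulerFam {v : ℝ → ℂ} {b r B : ℝ} {κ : ℂ}
    (hv : ContDiffOn ℝ ((⊤ : ℕ∞) : WithTop ℕ∞) v (Ioo 1 b)) (hbd : EulerBound v r B) (hBb : B ≤ b)
    (hr : -1 < r) (hκ : κ.re < 1) (n : ℕ) (c : ℂ) (j : ℕ) {z : ℝ} (hz : 1 < z) (hzB : z < B) :
    HasDerivAt (fun ζ => eulerFam v κ n c j ζ) (eulerFam v κ (n + 1) c j z) z := by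
  induction n generalizing c j with
  | zero =>
    have hK : HasDerivAt (fun ζ : ℝ => eulerKernel c (ζ - 1)) (-c * eulerKernel (c + 1) (z - 1)) z :=
      (hasDerivAt_eulerKernel c (sub_pos.mpr hz)).comp_sub_const z 1
    have h := hK.mul (hasDerivAt_eulerΨ hv hbd hBb hr hκ j hz hzB)
    show HasDerivAt (fun ζ => eulerKernel c (ζ - 1) * eulerΨ κ v j ζ)
      (-c * (eulerKernel (c + 1) (z - 1) * eulerΨ κ v j z) + eulerKernel c (z - 1) * eulerΨ κ v (j + 1) z) z
    refine h.congr_deriv ?_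
    ring
  | succ n ih =>
    have h := ((ih (c + 1) j).const_mul (-c)).add (ih c (j + 1))
    exact h

/-- `∂_z^n Φ_κ[v](z) = eulerFam v κ n (κ−1) 0 z` on `(1,B)` (`Re κ < 1`).
[cite: SamkoKilbasMarichev1993, §2 (Riemann–Liouville derivatives)] -/
theorem iteratedDeriv_eulerΦ_eq_eulerFam {v : ℝ → ℂ} {b r B : ℝ} {κ : ℂ}
    (hv : ContDiffOn ℝ ((⊤ : ℕ∞) : WithTop ℕ∞) v (Ioo 1 b)) (hbd : EulerBound v r B) (hBb : B ≤ b)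
    (hr : -1 < r) (hκ : κ.re < 1) (n : ℕ) {z : ℝ} (hz : z ∈ Ioo 1 B) :
    iteratedDeriv n (eulerΦ κ v) z = eulerFam v κ n (κ - 1) 0 z := by
  induction n generalizing z with
  | zero => rfl
  | succ n ih =>
    rw [iteratedDeriv_succ]
    have hloc : iteratedDeriv n (eulerΦ κ v) =ᶠ[𝓝 z] fun ζ => eulerFam v κ n (κ - 1) 0 ζ := by
      filter_upwards [Ioo_mem_nhds hz.1 hz.2] with x hx using ih hx
    rw [hloc.deriv_eq]
    exact (hasDerivAt_eulerFam hv hbd hBb hr hκ n (κ - 1) 0 hz.1 hz.2).deriv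

/-- `κ ↦ k_{κ+d}(u)` is entire. [cite: Takemura2017, Proposition 1.2 (kernel)] -/
theorem differentiable_eulerKernel_kappa (d : ℂ) (u : ℝ) :
    Differentiable ℂ (fun κ : ℂ => eulerKernel (κ + d) u) := by
  unfold eulerKernel
  fun_prop

/-- **Holomorphy of the derivative family in the exponent.** For fixed `z ∈ (1,B]`, `n`, `j` and a
shift `d`, the function `κ ↦ eulerFam v (κ−k) n (κ+d) j z` is holomorphic on the half-plane
`{Re κ < k+1}`. [cite: SamkoKilbasMarichev1993, §2 (analyticity of `I^α φ` in `α`)] -/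
theorem differentiableOn_eulerFam_kappa {v : ℝ → ℂ} {b r B : ℝ}
    (hv : ContDiffOn ℝ ((⊤ : ℕ∞) : WithTop ℕ∞) v (Ioo 1 b)) (hbd : EulerBound v r B) (hBb : B ≤ b)
    (hr : -1 < r) (k n : ℕ) (d : ℂ) (j : ℕ) {z : ℝ} (hz : 1 < z) (hzB : z ≤ B) :
    DifferentiableOn ℂ (fun κ : ℂ => eulerFam v (κ - k) n (κ + d) j z) {κ : ℂ | κ.re < k + 1} := by
  induction n generalizing d j with
  | zero =>
    have h2 : DifferentiableOn ℂ (fun κ : ℂ => eulerΨ (κ - k) v j z) {κ : ℂ | κ.re < k + 1} := by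
      intro κ hκ
      have hκ' : (κ - k).re < 1 := by
        have : (κ - (k : ℂ)).re = κ.re - k := by simp
        rw [this]; simp only [mem_setOf_eq] at hκ; linarith
      have h := hasDerivAt_eulerΨ_kappa hv hbd hBb hr hκ' j hz hzB
      exact (h.comp κ ((hasDerivAt_id κ).sub_const (k : ℂ))).differentiableAt.differentiableWithinAt
    exact ((differentiable_eulerKernel_kappa d (z - 1)).differentiableOn).mul h2
  | succ n ih =>
    have ha : DifferentiableOn ℂ (fun κ : ℂ => eulerFam v (κ - k) n (κ + d + 1) j z)
        {κ : ℂ | κ.re < k + 1} := by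
      have h := ih (d + 1) j
      simpa only [add_assoc] using h
    have hb := ih d (j + 1)
    have hc : DifferentiableOn ℂ (fun κ : ℂ => -(κ + d)) {κ : ℂ | κ.re < k + 1} :=
      (differentiableOn_id.add (differentiableOn_const d)).neg
    exact (hc.mul ha).add hb

/-! ### Smoothness of `Φ_κ[v]` and the lowering recursion `∂_z Φ_{κ−1} = (1−κ) Φ_κ` -/

/-- `ζ ↦ k_c(ζ−1)` is smooth on `(1, ∞)`. [cite: Takemura2017, Proposition 1.2 (kernel)] -/
theorem contDiffOn_eulerKernel_sub_one (c : ℂ) :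
    ContDiffOn ℝ ((⊤ : ℕ∞) : WithTop ℕ∞) (fun ζ : ℝ => eulerKernel c (ζ - 1)) (Ioi 1) := by
  unfold eulerKernel
  have hlog : ContDiffOn ℝ ((⊤ : ℕ∞) : WithTop ℕ∞) (fun ζ : ℝ => Real.log (ζ - 1)) (Ioi 1) :=
    Real.contDiffOn_log.comp (contDiffOn_id.sub contDiffOn_const) fun ζ hζ =>
      ne_of_gt (sub_pos.mpr hζ)
  have h1 : ContDiffOn ℝ ((⊤ : ℕ∞) : WithTop ℕ∞) (fun ζ : ℝ => (Real.log (ζ - 1) : ℂ)) (Ioi 1) :=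
    Complex.ofRealCLM.contDiff.comp_contDiffOn hlog
  exact Complex.contDiff_exp.comp_contDiffOn (contDiffOn_const.mul h1)

/-- `Φ_κ[v]` is smooth on `(1,B)` (`Re κ < 1`). [cite: SamkoKilbasMarichev1993, §2] -/
theorem contDiffOn_eulerΦ {v : ℝ → ℂ} {b r B : ℝ} {κ : ℂ}
    (hv : ContDiffOn ℝ ((⊤ : ℕ∞) : WithTop ℕ∞) v (Ioo 1 b)) (hbd : EulerBound v r B) (hBb : B ≤ b)
    (hr : -1 < r) (hκ : κ.re < 1) :
    ContDiffOn ℝ ((⊤ : ℕ∞) : WithTop ℕ∞) (eulerΦ κ v) (Ioo 1 B) :=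
  ((contDiffOn_eulerKernel_sub_one (κ - 1)).mono fun _ hz => hz.1).mul
    (contDiffOn_eulerΨ hv hbd hBb hr hκ 0)

/-- **The lowering recursion** `d/dz Φ_{κ−1}[v] = (1−κ) Φ_κ[v]` on `(1,B)` (`Re κ < 1`), i.e.
`d/dz ∫₁^z (z−w)^{1−κ} v(w) dw = (1−κ) ∫₁^z (z−w)^{−κ} v(w) dw`.
[cite: SamkoKilbasMarichev1993, §2 (differentiation of Riemann–Liouville integrals)] -/
theorem hasDerivAt_eulerΦ_pred {v : ℝ → ℂ} {b r B : ℝ} {κ : ℂ}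
    (hv : ContDiffOn ℝ ((⊤ : ℕ∞) : WithTop ℕ∞) v (Ioo 1 b)) (hbd : EulerBound v r B) (hBb : B ≤ b)
    (hr : -1 < r) (hκ : κ.re < 1) {z : ℝ} (hz : 1 < z) (hzB : z < B) :
    HasDerivAt (eulerΦ (κ - 1) v) ((1 - κ) * eulerΦ κ v z) z := by
  have hz1 : 0 < z - 1 := sub_pos.mpr hz
  have hκ' : (κ - 1).re < 1 := by simp; linarith
  have hK : HasDerivAt (fun ζ : ℝ => eulerKernel (κ - 1 - 1) (ζ - 1))
      ((1 - (κ - 1)) * eulerKernel (κ - 1) (z - 1)) z :=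
    (hasDerivAt_eulerKernel_pred (κ - 1) hz1).comp_sub_const z 1
  have h := hK.mul (hasDerivAt_eulerΨ hv hbd hBb hr hκ' 0 hz hzB)
  have hrec := eulerΨ_recursion hv hbd hBb hr hκ hz hzB
  have hs : eulerKernel (κ - 1 - 1) (z - 1) = ((z - 1 : ℝ) : ℂ) * eulerKernel (κ - 1) (z - 1) := by
    rw [← mul_eulerKernel_succ (κ - 1 - 1) hz1, sub_add_cancel]
  unfold eulerΦ
  refine h.congr_deriv ?_
  rw [hs]
  linear_combination eulerKernel (κ - 1) (z - 1) * hrec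

/-- Iterated form of the lowering recursion:
`∂_z^{n+1} Φ_{κ−1}[v](z) = (1−κ) ∂_z^n Φ_κ[v](z)` on `(1,B)` (`Re κ < 1`).
[cite: SamkoKilbasMarichev1993, §2 (differentiation of Riemann–Liouville integrals)] -/
theorem iteratedDeriv_eulerΦ_pred {v : ℝ → ℂ} {b r B : ℝ} {κ : ℂ}
    (hv : ContDiffOn ℝ ((⊤ : ℕ∞) : WithTop ℕ∞) v (Ioo 1 b)) (hbd : EulerBound v r B) (hBb : B ≤ b)
    (hr : -1 < r) (hκ : κ.re < 1) (n : ℕ) {z : ℝ} (hz : z ∈ Ioo 1 B) :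
    iteratedDeriv (n + 1) (eulerΦ (κ - 1) v) z = (1 - κ) * iteratedDeriv n (eulerΦ κ v) z := by
  rw [iteratedDeriv_succ']
  have hloc : deriv (eulerΦ (κ - 1) v) =ᶠ[𝓝 z] fun ζ => (1 - κ) * eulerΦ κ v ζ := by
    filter_upwards [Ioo_mem_nhds hz.1 hz.2] with x hx
    exact (hasDerivAt_eulerΦ_pred hv hbd hBb hr hκ hx.1 hx.2).deriv
  rw [(hloc.iteratedDeriv n).eq_of_nhds]
  have hcd : ContDiffAt ℝ (n : WithTop ℕ∞) (eulerΦ κ v) z :=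
    ((contDiffOn_eulerΦ hv hbd hBb hr hκ).contDiffAt (Ioo_mem_nhds hz.1 hz.2)).of_le
      (by exact_mod_cast le_top)
  exact iteratedDeriv_const_mul (1 - κ) hcd

/-- The rising product `c_k(κ) = (1−κ)(2−κ)⋯(k−κ)`. [cite: SamkoKilbasMarichev1993, §2] -/
def eulerC : ℕ → ℂ → ℂ
  | 0, _ => 1
  | k + 1, κ => ((k : ℂ) + 1 - κ) * eulerC k κ

/-- **`∂_z^{k+m} Φ_{κ−k}[v] = c_k(κ)·∂_z^m Φ_κ[v]` on `(1,B)` for `Re κ < 1`** (the regularised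
transform agrees with the plain one where both converge).
[cite: SamkoKilbasMarichev1993, §2 (`D^k I^{k+α} = I^α`)] -/
theorem iteratedDeriv_eulerΦ_sub_nat {v : ℝ → ℂ} {b r B : ℝ} {κ : ℂ}
    (hv : ContDiffOn ℝ ((⊤ : ℕ∞) : WithTop ℕ∞) v (Ioo 1 b)) (hbd : EulerBound v r B) (hBb : B ≤ b)
    (hr : -1 < r) (hκ : κ.re < 1) (k m : ℕ) {z : ℝ} (hz : z ∈ Ioo 1 B) :
    iteratedDeriv (k + m) (eulerΦ (κ - k) v) z = eulerC k κ * iteratedDeriv m (eulerΦ κ v) z := by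
  induction k with
  | zero => simp [eulerC]
  | succ k ih =>
    have hκk : (κ - k).re < 1 := by
      have : (κ - (k : ℂ)).re = κ.re - k := by simp
      rw [this]; linarith [(Nat.cast_nonneg k : (0 : ℝ) ≤ k)]
    have e1 : (κ - ((k + 1 : ℕ) : ℂ)) = (κ - k) - 1 := by push_cast; ring
    have e2 : k + 1 + m = (k + m) + 1 := by ring
    rw [e1, e2, iteratedDeriv_eulerΦ_pred hv hbd hBb hr hκk (k + m) hz, ih]
    simp only [eulerC]
    ring

/-- `∂_z Φ_κ[v] = eulerΦ₁` as an iterated derivative. [cite: Takemura2017, Proposition 1.2] -/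
theorem iteratedDeriv_one_eulerΦ {v : ℝ → ℂ} {b r B : ℝ} {κ : ℂ}
    (hv : ContDiffOn ℝ ((⊤ : ℕ∞) : WithTop ℕ∞) v (Ioo 1 b)) (hbd : EulerBound v r B) (hBb : B ≤ b)
    (hr : -1 < r) (hκ : κ.re < 1) {z : ℝ} (hz : z ∈ Ioo 1 B) :
    iteratedDeriv 1 (eulerΦ κ v) z = eulerΦ₁ κ v z := by
  rw [iteratedDeriv_one]
  exact (hasDerivAt_eulerΦ hv hbd hBb hr hκ hz.1 hz.2).deriv

/-- `∂_z² Φ_κ[v] = eulerΦ₂` as an iterated derivative. [cite: Takemura2017, Proposition 1.2] -/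
theorem iteratedDeriv_two_eulerΦ {v : ℝ → ℂ} {b r B : ℝ} {κ : ℂ}
    (hv : ContDiffOn ℝ ((⊤ : ℕ∞) : WithTop ℕ∞) v (Ioo 1 b)) (hbd : EulerBound v r B) (hBb : B ≤ b)
    (hr : -1 < r) (hκ : κ.re < 1) {z : ℝ} (hz : z ∈ Ioo 1 B) :
    iteratedDeriv 2 (eulerΦ κ v) z = eulerΦ₂ κ v z := by
  rw [show (2 : ℕ) = 1 + 1 from rfl, iteratedDeriv_succ, iteratedDeriv_one]
  have hloc : deriv (eulerΦ κ v) =ᶠ[𝓝 z] eulerΦ₁ κ v := by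
    filter_upwards [Ioo_mem_nhds hz.1 hz.2] with x hx
    exact (hasDerivAt_eulerΦ hv hbd hBb hr hκ hx.1 hx.2).deriv
  rw [hloc.deriv_eq]
  exact (hasDerivAt_eulerΦ₁ hv hbd hBb hr hκ hz.1 hz.2).deriv

/-! ### The companion function `w ↦ w·v(w)` stays in the class -/

/-- Leibniz for a linear factor: `∂^j (w v) = w v⁽ʲ⁾ + j v⁽ʲ⁻¹⁾` on the open interval where `v` is
smooth. [folklore] -/
private theorem iteratedDeriv_ofReal_mul {v : ℝ → ℂ} {b : ℝ}
    (hv : ContDiffOn ℝ ((⊤ : ℕ∞) : WithTop ℕ∞) v (Ioo 1 b)) :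
    ∀ j : ℕ, ∀ w ∈ Ioo 1 b, iteratedDeriv j (fun u : ℝ => (u : ℂ) * v u) w =
      (w : ℂ) * iteratedDeriv j v w + (j : ℂ) * iteratedDeriv (j - 1) v w
  | 0 => by intro w _; simp
  | j + 1 => by
    intro w hw
    have hopen : IsOpen (Ioo 1 b) := isOpen_Ioo
    -- chain of derivatives of `v`
    have hchain : ∀ i : ℕ, ∀ u ∈ Ioo 1 b, HasDerivAt (iteratedDeriv i v) (iteratedDeriv (i + 1) v u) u := by
      intro i u hu
      have hdiff : DifferentiableOn ℝ (iteratedDerivWithin i v (Ioo 1 b)) (Ioo 1 b) :=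
        hv.differentiableOn_iteratedDerivWithin (WithTop.coe_lt_coe.2 (ENat.coe_lt_top i))
          hopen.uniqueDiffOn
      have heq : iteratedDerivWithin i v (Ioo 1 b) =ᶠ[𝓝 u] iteratedDeriv i v := by
        filter_upwards [hopen.mem_nhds hu] with x hx using iteratedDerivWithin_of_isOpen hopen hx
      have h1 : DifferentiableAt ℝ (iteratedDeriv i v) u :=
        ((hdiff u hu).differentiableAt (hopen.mem_nhds hu)).congr_of_eventuallyEq heq.symm
      rw [iteratedDeriv_succ]
      exact h1.hasDerivAt
    rw [iteratedDeriv_succ]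
    have hloc : iteratedDeriv j (fun u : ℝ => (u : ℂ) * v u) =ᶠ[𝓝 w]
        fun u => (u : ℂ) * iteratedDeriv j v u + (j : ℂ) * iteratedDeriv (j - 1) v u := by
      filter_upwards [hopen.mem_nhds hw] with u hu using iteratedDeriv_ofReal_mul hv j u hu
    rw [hloc.deriv_eq]
    have hc : HasDerivAt (fun u : ℝ => (u : ℂ)) 1 w := by
      simpa using (hasDerivAt_id w).ofReal_comp
    have h : HasDerivAt (fun u : ℝ => (u : ℂ) * iteratedDeriv j v u + (j : ℂ) * iteratedDeriv (j - 1) v u)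
        (1 * iteratedDeriv j v w + (w : ℂ) * iteratedDeriv (j + 1) v w +
          (j : ℂ) * iteratedDeriv (j - 1 + 1) v w) w :=
      (hc.mul (hchain j w hw)).add ((hchain (j - 1) w hw).const_mul (j : ℂ))
    rw [h.deriv]
    rcases j with _ | j
    · simp; ring
    · simp only [Nat.add_sub_cancel]
      push_cast
      ring

/-- `w ↦ w·v(w)` inherits the branch-type derivative bounds (on a bounded interval).
[cite: SamkoKilbasMarichev1993, §2] -/
theorem EulerBound.ofReal_mul {v : ℝ → ℂ} {b r B : ℝ}
    (hv : ContDiffOn ℝ ((⊤ : ℕ∞) : WithTop ℕ∞) v (Ioo 1 b)) (hbd : EulerBound v r B) (hBb : B ≤ b) :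
    EulerBound (fun u : ℝ => (u : ℂ) * v u) r B := by
  intro j
  obtain ⟨C, hC⟩ := hbd j
  obtain ⟨C', hC'⟩ := hbd (j - 1)
  refine ⟨|B| * |C| + (j : ℝ) * |C'| * |B - 1|, fun w hw => ?_⟩
  have hwb : w ∈ Ioo 1 b := ⟨hw.1, hw.2.trans_le hBb⟩
  have hw1 : 0 < w - 1 := sub_pos.mpr hw.1
  rw [iteratedDeriv_ofReal_mul hv j w hwb]
  have h1 : ‖(w : ℂ) * iteratedDeriv j v w‖ ≤ |B| * |C| * (w - 1) ^ (r - (j : ℝ)) := by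
    rw [norm_mul, Complex.norm_real, Real.norm_eq_abs]
    have hwB : |w| ≤ |B| := by
      rw [abs_of_pos (by linarith [hw.1]), ]; exact hw.2.le.trans (le_abs_self B)
    have hCj : ‖iteratedDeriv j v w‖ ≤ |C| * (w - 1) ^ (r - (j : ℝ)) :=
      (hC w hw).trans (mul_le_mul_of_nonneg_right (le_abs_self C) (Real.rpow_nonneg hw1.le _))
    calc |w| * ‖iteratedDeriv j v w‖ ≤ |B| * (|C| * (w - 1) ^ (r - (j : ℝ))) :=
          mul_le_mul hwB hCj (norm_nonneg _) (abs_nonneg B)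
      _ = |B| * |C| * (w - 1) ^ (r - (j : ℝ)) := by ring
  have h2 : ‖(j : ℂ) * iteratedDeriv (j - 1) v w‖ ≤ (j : ℝ) * |C'| * |B - 1| * (w - 1) ^ (r - (j : ℝ)) := by
    rcases Nat.eq_zero_or_pos j with hj | hj
    · subst hj; simp
    · rw [norm_mul, Complex.norm_natCast]
      have hCj : ‖iteratedDeriv (j - 1) v w‖ ≤ |C'| * (w - 1) ^ (r - ((j - 1 : ℕ) : ℝ)) :=
        (hC' w hw).trans (mul_le_mul_of_nonneg_right (le_abs_self C') (Real.rpow_nonneg hw1.le _))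
      have hexp : (w - 1) ^ (r - ((j - 1 : ℕ) : ℝ)) = (w - 1) ^ (r - (j : ℝ)) * (w - 1) := by
        rw [Nat.cast_sub hj, Nat.cast_one, show r - ((j : ℝ) - 1) = (r - j) + 1 by ring,
          Real.rpow_add hw1, Real.rpow_one]
      have hwB : w - 1 ≤ |B - 1| := by
        have : w - 1 ≤ B - 1 := by linarith [hw.2]
        exact this.trans (le_abs_self _)
      calc (j : ℝ) * ‖iteratedDeriv (j - 1) v w‖ ≤ (j : ℝ) * (|C'| * ((w - 1) ^ (r - (j : ℝ)) * (w - 1))) := by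
            rw [← hexp]; exact mul_le_mul_of_nonneg_left hCj (Nat.cast_nonneg j)
        _ ≤ (j : ℝ) * (|C'| * ((w - 1) ^ (r - (j : ℝ)) * |B - 1|)) := by
            gcongr
        _ = (j : ℝ) * |C'| * |B - 1| * (w - 1) ^ (r - (j : ℝ)) := by ring
  calc ‖(w : ℂ) * iteratedDeriv j v w + (j : ℂ) * iteratedDeriv (j - 1) v w‖
      ≤ ‖(w : ℂ) * iteratedDeriv j v w‖ + ‖(j : ℂ) * iteratedDeriv (j - 1) v w‖ := norm_add_le _ _
    _ ≤ |B| * |C| * (w - 1) ^ (r - (j : ℝ)) + (j : ℝ) * |C'| * |B - 1| * (w - 1) ^ (r - (j : ℝ)) :=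
        add_le_add h1 h2
    _ = (|B| * |C| + (j : ℝ) * |C'| * |B - 1|) * (w - 1) ^ (r - (j : ℝ)) := by ring

/-- Scaling preserves the bounds. [cite: SamkoKilbasMarichev1993, §2] -/
theorem EulerBound.const_mul {v : ℝ → ℂ} {b r B : ℝ}
    (hv : ContDiffOn ℝ ((⊤ : ℕ∞) : WithTop ℕ∞) v (Ioo 1 b)) (hbd : EulerBound v r B) (hBb : B ≤ b)
    (c : ℂ) : EulerBound (fun u : ℝ => c * v u) r B := by
  intro j
  obtain ⟨C, hC⟩ := hbd j
  refine ⟨‖c‖ * C, fun w hw => ?_⟩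
  have hwb : w ∈ Ioo 1 b := ⟨hw.1, hw.2.trans_le hBb⟩
  have hcd : ContDiffAt ℝ (j : WithTop ℕ∞) v w :=
    (hv.contDiffAt (isOpen_Ioo.mem_nhds hwb)).of_le (by exact_mod_cast le_top)
  rw [iteratedDeriv_const_mul c hcd, norm_mul, mul_assoc]
  exact mul_le_mul_of_nonneg_left (hC w hw) (norm_nonneg c)

/-- `Ψ_{κ,0}` is linear in the function: `Ψ_{κ,0}[c·f] = c·Ψ_{κ,0}[f]`.
[cite: Takemura2017, Proposition 1.2] -/
theorem eulerΦ_const_mul (κ c : ℂ) (f : ℝ → ℂ) (z : ℝ) :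
    eulerΦ κ (fun u : ℝ => c * f u) z = c * eulerΦ κ f z := by
  unfold eulerΦ eulerΨ eulerΨIntegrand
  simp only [iteratedDeriv_zero]
  rw [← intervalIntegral.integral_const_mul, ← intervalIntegral.integral_const_mul,
    ← intervalIntegral.integral_const_mul]
  refine intervalIntegral.integral_congr fun t _ => ?_
  ring

/-! ### The affine family of targets `T(κ) = eulerSrc-map(S, 2−κ)` and its source operators -/

/-- Along the family `T(κ)`, the source operator `S(κ) = eulerSrc-map(T(κ), κ)` has the SAME
`γ, δ, ε, q` as `S` and the exponent pair `{2−κ, α+β−2+κ}`; hence for a solution `v` of `M_S v = 0`,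
`M_{S(κ)} v = c(κ)·w·v(w)` with `c(κ) = (2−κ)(α+β−2+κ) − αβ`.
[cite: Takemura2017, remark after Proposition 1.2 (involution)] -/
theorem heunFamily_source {aH α β γ δ ε q κ : ℂ} {v D₁ D₂ : ℝ → ℂ} {w : ℝ}
    (hsol : lead aH w * D₂ w + mid aH γ δ ε w * D₁ w + low α β q w * v w = 0) :
    lead aH w * D₂ w +
      mid aH (eulerSrc (eulerSrc γ (2 - κ)) κ) (eulerSrc (eulerSrc δ (2 - κ)) κ)
        (eulerSrc (eulerSrc ε (2 - κ)) κ) w * D₁ w +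
      low (eulerSrcα κ) (eulerSrcβ (eulerSrcα (2 - κ)) (eulerSrcβ α β (2 - κ)) κ)
        (eulerSrcQ aH (eulerSrc γ (2 - κ)) (eulerSrc δ (2 - κ)) (eulerSrc ε (2 - κ))
          (eulerSrcQ aH γ δ ε q (2 - κ)) κ) w * v w =
      ((2 - κ) * (α + β - 2 + κ) - α * β) * ((w : ℂ) * v w) := by
  unfold lead mid low eulerSrc eulerSrcα eulerSrcβ eulerSrcQ at *
  linear_combination hsol

/-! ### The main theorem -/

/-- On an open set, the iterated derivatives of a smooth function form a chain of honest
derivatives. [folklore] -/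
private theorem hasDerivAt_iteratedDeriv_of_contDiffOn' {f : ℝ → ℂ} {U : Set ℝ} (hU : IsOpen U)
    (hf : ContDiffOn ℝ ((⊤ : ℕ∞) : WithTop ℕ∞) f U) (j : ℕ) {w : ℝ} (hw : w ∈ U) :
    HasDerivAt (iteratedDeriv j f) (iteratedDeriv (j + 1) f w) w := by
  have hdiff : DifferentiableOn ℝ (iteratedDerivWithin j f U) U :=
    hf.differentiableOn_iteratedDerivWithin (WithTop.coe_lt_coe.2 (ENat.coe_lt_top j))
      hU.uniqueDiffOn
  have heq : iteratedDerivWithin j f U =ᶠ[𝓝 w] iteratedDeriv j f := by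
    filter_upwards [hU.mem_nhds hw] with x hx using iteratedDerivWithin_of_isOpen hU hx
  have h1 : DifferentiableAt ℝ (iteratedDeriv j f) w :=
    ((hdiff w hw).differentiableAt (hU.mem_nhds hw)).congr_of_eventuallyEq heq.symm
  rw [iteratedDeriv_succ]
  exact h1.hasDerivAt

/-- The half-plane `{Re κ < c}` is open and preconnected. [folklore] -/
private theorem halfPlane_facts (c : ℝ) :
    IsOpen {κ : ℂ | κ.re < c} ∧ IsPreconnected {κ : ℂ | κ.re < c} := by
  refine ⟨isOpen_lt Complex.continuous_re continuous_const, ?_⟩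
  have hlin : IsLinearMap ℝ (fun κ : ℂ => κ.re) :=
    { map_add := fun x y => Complex.add_re x y
      map_smul := fun c x => by simp }
  exact (convex_halfSpace_lt hlin c).isPreconnected

/-- **The derivative-regularised Euler transform solves the target equation (identity along the
family `T(κ)`, all `κ` with `Re κ < k+1`).** For a smooth `v` on `(1,b)` with branch-type bounds,
exact chart `(w−1)^ρ h` (`ρ = 1−δ`, `Re ρ > −1`) and `M_S v = 0` on `(1,B)`
(`S = (a_H; α,β; γ,δ,ε; q)` with the Fuchs relation), and for every `κ` with `Re κ < k+1`:
`lead(z)·∂_z^{k+2}Φ_{κ−k}[v] + mid_{T(κ)}(z)·∂_z^{k+1}Φ_{κ−k}[v] + low_{T(κ)}(z)·∂_z^kΦ_{κ−k}[v]`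
`  = c(κ)·∂_z^kΦ_{κ−k}[w·v](z)`, `T(κ) = eulerSrc-map(S, 2−κ)`, `c(κ) = (2−κ)(α+β−2+κ) − αβ`
(derivatives written with `eulerFam`). Proof: both sides are holomorphic in `κ` on the half-plane;
for `Re κ < 1` the identity is `heunOperator_eulerΦ` (target `T(κ)`, inhomogeneity `c(κ)·w·v`)
combined with `∂_z^kΦ_{κ−k} = c_k(κ)Φ_κ`; conclude by the identity theorem.
[cite: Takemura2017, Proposition 1.2] -/
theorem heunFamily_identity {aH α β γ δ ε q ρ : ℂ} {v : ℝ → ℂ} {b r B : ℝ} (k : ℕ)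
    (hF : γ + δ + ε = α + β + 1)
    (hv : ContDiffOn ℝ ((⊤ : ℕ∞) : WithTop ℕ∞) v (Ioo 1 b)) (hbd : EulerBound v r B) (hBb : B ≤ b)
    (hr : -1 < r) (hρ : ρ = 1 - δ) (hρre : -1 < ρ.re)
    (hchart : ∃ e : ℝ, 0 < e ∧ ∃ h : ℝ → ℂ, ContDiffOn ℝ ((⊤ : ℕ∞) : WithTop ℕ∞) h (Ioo (1 - e) (1 + e)) ∧
      ∀ w ∈ Ioo 1 (1 + e), v w = ((w - 1 : ℝ) : ℂ) ^ ρ * h w)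
    (hsol : ∀ w ∈ Ioo 1 B, lead aH w * iteratedDeriv 2 v w + mid aH γ δ ε w * iteratedDeriv 1 v w +
      low α β q w * v w = 0)
    {z : ℝ} (hz : 1 < z) (hzB : z < B) {κ : ℂ} (hκ : κ.re < k + 1) :
    lead aH z * eulerFam v (κ - k) (k + 2) (κ - k - 1) 0 z +
      mid aH (eulerSrc γ (2 - κ)) (eulerSrc δ (2 - κ)) (eulerSrc ε (2 - κ)) z *
        eulerFam v (κ - k) (k + 1) (κ - k - 1) 0 z +
      low (eulerSrcα (2 - κ)) (eulerSrcβ α β (2 - κ)) (eulerSrcQ aH γ δ ε q (2 - κ)) z *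
        eulerFam v (κ - k) k (κ - k - 1) 0 z =
      ((2 - κ) * (α + β - 2 + κ) - α * β) *
        eulerFam (fun u : ℝ => (u : ℂ) * v u) (κ - k) k (κ - k - 1) 0 z := by
  -- the companion function `w v(w)` is in the class
  set vs : ℝ → ℂ := fun u : ℝ => (u : ℂ) * v u with hvs
  have hvs_smooth : ContDiffOn ℝ ((⊤ : ℕ∞) : WithTop ℕ∞) vs (Ioo 1 b) :=
    (Complex.ofRealCLM.contDiff.comp_contDiffOn contDiffOn_id).mul hv
  have hvs_bd : EulerBound vs r B := EulerBound.ofReal_mul hv hbd hBb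
  -- the two sides as functions of `κ`
  set L : ℂ → ℂ := fun κ => lead aH z * eulerFam v (κ - k) (k + 2) (κ - k - 1) 0 z +
      mid aH (eulerSrc γ (2 - κ)) (eulerSrc δ (2 - κ)) (eulerSrc ε (2 - κ)) z *
        eulerFam v (κ - k) (k + 1) (κ - k - 1) 0 z +
      low (eulerSrcα (2 - κ)) (eulerSrcβ α β (2 - κ)) (eulerSrcQ aH γ δ ε q (2 - κ)) z *
        eulerFam v (κ - k) k (κ - k - 1) 0 z with hL
  set R : ℂ → ℂ := fun κ => ((2 - κ) * (α + β - 2 + κ) - α * β) * eulerFam vs (κ - k) k (κ - k - 1) 0 z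
    with hR
  set U : Set ℂ := {κ : ℂ | κ.re < k + 1} with hU
  obtain ⟨hUo, hUc⟩ := halfPlane_facts ((k : ℝ) + 1)
  -- holomorphy of both sides on `U`
  have hfam : ∀ n, DifferentiableOn ℂ (fun κ : ℂ => eulerFam v (κ - k) n (κ - k - 1) 0 z) U := by
    intro n
    have h := differentiableOn_eulerFam_kappa hv hbd hBb hr k n (-(k : ℂ) - 1) 0 hz hzB.le
    refine h.congr fun κ _ => ?_
    simp only [show κ - (k : ℂ) - 1 = κ + (-(k : ℂ) - 1) by ring]
  have hfam' : DifferentiableOn ℂ (fun κ : ℂ => eulerFam vs (κ - k) k (κ - k - 1) 0 z) U := by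
    have h := differentiableOn_eulerFam_kappa hvs_smooth hvs_bd hBb hr k k (-(k : ℂ) - 1) 0 hz hzB.le
    refine h.congr fun κ _ => ?_
    simp only [show κ - (k : ℂ) - 1 = κ + (-(k : ℂ) - 1) by ring]
  have hL_an : AnalyticOnNhd ℂ L U := by
    refine DifferentiableOn.analyticOnNhd ?_ hUo
    rw [hL]
    have hmid : Differentiable ℂ fun κ : ℂ =>
        mid aH (eulerSrc γ (2 - κ)) (eulerSrc δ (2 - κ)) (eulerSrc ε (2 - κ)) z := by
      unfold mid eulerSrc; fun_prop
    have hlow : Differentiable ℂ fun κ : ℂ =>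
        low (eulerSrcα (2 - κ)) (eulerSrcβ α β (2 - κ)) (eulerSrcQ aH γ δ ε q (2 - κ)) z := by
      unfold low eulerSrcα eulerSrcβ eulerSrcQ; fun_prop
    exact (((differentiableOn_const _).mul (hfam (k + 2))).add (hmid.differentiableOn.mul (hfam (k + 1)))).add
      (hlow.differentiableOn.mul (hfam k))
  have hR_an : AnalyticOnNhd ℂ R U := by
    refine DifferentiableOn.analyticOnNhd ?_ hUo
    rw [hR]
    have hc : Differentiable ℂ fun κ : ℂ => (2 - κ) * (α + β - 2 + κ) - α * β := by fun_prop
    exact hc.differentiableOn.mul hfam'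
  -- the identity on `{Re κ < 1}`
  have hsmall : ∀ κ : ℂ, κ.re < 1 → L κ = R κ := by
    intro κ hκ1
    have hκk : (κ - k).re < 1 := by
      have : (κ - (k : ℂ)).re = κ.re - k := by simp
      rw [this]; linarith [(Nat.cast_nonneg k : (0 : ℝ) ≤ k)]
    have hzI : z ∈ Ioo 1 B := ⟨hz, hzB⟩
    -- `eulerFam … (k+m) … = c_k(κ) ∂^m Φ_κ`
    have hW : ∀ m, eulerFam v (κ - k) (k + m) (κ - k - 1) 0 z = eulerC k κ * iteratedDeriv m (eulerΦ κ v) z := by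
      intro m
      rw [← iteratedDeriv_eulerΦ_eq_eulerFam hv hbd hBb hr hκk (k + m) hzI]
      exact iteratedDeriv_eulerΦ_sub_nat hv hbd hBb hr hκ1 k m hzI
    have hW' : eulerFam vs (κ - k) k (κ - k - 1) 0 z = eulerC k κ * eulerΦ κ vs z := by
      have h1 := iteratedDeriv_eulerΦ_eq_eulerFam hvs_smooth hvs_bd hBb hr hκk (k + 0) hzI
      have h2 := iteratedDeriv_eulerΦ_sub_nat hvs_smooth hvs_bd hBb hr hκ1 k 0 hzI
      simp only [Nat.add_zero, iteratedDeriv_zero] at h1 h2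
      rw [← h1, h2]
    have h0 : eulerFam v (κ - k) k (κ - k - 1) 0 z = eulerC k κ * eulerΦ κ v z := by
      have h := hW 0; rw [Nat.add_zero, iteratedDeriv_zero] at h; exact h
    have h1 : eulerFam v (κ - k) (k + 1) (κ - k - 1) 0 z = eulerC k κ * eulerΦ₁ κ v z := by
      rw [hW 1, iteratedDeriv_one_eulerΦ hv hbd hBb hr hκ1 hzI]
    have h2 : eulerFam v (κ - k) (k + 2) (κ - k - 1) 0 z = eulerC k κ * eulerΦ₂ κ v z := by
      rw [hW 2, iteratedDeriv_two_eulerΦ hv hbd hBb hr hκ1 hzI]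
    -- Euler's theorem for the target `T(κ)` with inhomogeneity `c(κ)·w·v`
    set cκ : ℂ := (2 - κ) * (α + β - 2 + κ) - α * β with hcκ
    have hg_smooth : ContDiffOn ℝ ((⊤ : ℕ∞) : WithTop ℕ∞) (fun u : ℝ => cκ * vs u) (Ioo 1 b) :=
      contDiffOn_const.mul hvs_smooth
    have hg_bd : EulerBound (fun u : ℝ => cκ * vs u) r B := EulerBound.const_mul hvs_smooth hvs_bd hBb cκ
    have hE := heunOperator_eulerΦ (aH := aH) (α := eulerSrcα (2 - κ)) (β := eulerSrcβ α β (2 - κ))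
      (γ := eulerSrc γ (2 - κ)) (δ := eulerSrc δ (2 - κ)) (ε := eulerSrc ε (2 - κ))
      (q := eulerSrcQ aH γ δ ε q (2 - κ)) (κ := κ) (ρ := ρ) (g := fun u : ℝ => cκ * vs u)
      (euler_fuchs (2 - κ) hF) (by unfold eulerSrcα; ring) hκ1 hv hbd hBb hr
      (by rw [hρ]; unfold eulerSrc; ring) hρre hchart hg_smooth hg_bd ?_ hz hzB
    · rw [hL, hR]
      simp only []
      rw [h0, h1, h2, hW', eulerΦ_const_mul] at *
      linear_combination eulerC k κ * hE
    · intro w hw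
      have h := heunFamily_source (κ := κ) (D₁ := iteratedDeriv 1 v) (D₂ := iteratedDeriv 2 v) (hsol w hw)
      rw [h]
  -- identity theorem on the half-plane
  have h0U : (0 : ℂ) ∈ U := by
    simp only [hU, mem_setOf_eq, Complex.zero_re]; linarith [(Nat.cast_nonneg k : (0 : ℝ) ≤ k)]
  have hev : L =ᶠ[𝓝 (0 : ℂ)] R := by
    have hopen : IsOpen {κ : ℂ | κ.re < 1} := isOpen_lt Complex.continuous_re continuous_const
    filter_upwards [hopen.mem_nhds (by simp : (0 : ℂ) ∈ {κ : ℂ | κ.re < 1})] with κ hκ1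
    exact hsmall κ hκ1
  have heq := hL_an.eqOn_of_preconnected_of_eventuallyEq hR_an hUc h0U hev
  have := heq (show κ ∈ U from hκ)
  simpa only [hL, hR] using this

/-- **The derivative-regularised Euler transform of a Heun solution is a Heun solution
(Takemura's Proposition 1.2 along the real segment, every kernel exponent).** Let the SOURCE
parameters `(a_H; α, β; γ, δ, ε; q)` satisfy the Fuchs relation, let `η` be a root
(`(η−α)(η−β) = 0`), and let `k` be a regularisation order with `Re(2−η) < k+1`. Let `v` be smooth
on `(1,b)` with branch-type bounds `EulerBound v r B` (`B ≤ b`, `r > −1`), of exact branch form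
`(w−1)^ρ h` near `1⁺` (`ρ = 1−δ`, `Re ρ > −1`, `h` smooth two-sided) and `M_S v = 0` on `(1,B)`.
Then `u = ∂_z^k Φ_{2−η−k}[v]` — the Riemann–Liouville derivative of order `1−η` of `v` from the base
point `1`, i.e. Euler's transform with kernel `(z−w)^{η−2}` regularised by `k` derivatives —
satisfies the TARGET equation with Takemura's parameters
`(a_H; 2−η, α+β−2η+1; γ−η+1, δ−η+1, ε−η+1; eulerSrcQ)` on `(1,B)`:
`lead(z) u″ + mid_T(z) u′ + low_T(z) u = 0`. [cite: Takemura2017, Proposition 1.2] -/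
theorem heunOperator_iteratedDeriv_eulerΦ {aH α β γ δ ε q η ρ : ℂ} {v : ℝ → ℂ} {b r B : ℝ} (k : ℕ)
    (hF : γ + δ + ε = α + β + 1) (hη : (η - α) * (η - β) = 0) (hθ : (2 - η).re < k + 1)
    (hv : ContDiffOn ℝ ((⊤ : ℕ∞) : WithTop ℕ∞) v (Ioo 1 b)) (hbd : EulerBound v r B) (hBb : B ≤ b)
    (hr : -1 < r) (hρ : ρ = 1 - δ) (hρre : -1 < ρ.re)
    (hchart : ∃ e : ℝ, 0 < e ∧ ∃ h : ℝ → ℂ, ContDiffOn ℝ ((⊤ : ℕ∞) : WithTop ℕ∞) h (Ioo (1 - e) (1 + e)) ∧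
      ∀ w ∈ Ioo 1 (1 + e), v w = ((w - 1 : ℝ) : ℂ) ^ ρ * h w)
    (hsol : ∀ w ∈ Ioo 1 B, lead aH w * iteratedDeriv 2 v w + mid aH γ δ ε w * iteratedDeriv 1 v w +
      low α β q w * v w = 0)
    {z : ℝ} (hz : 1 < z) (hzB : z < B) :
    lead aH z * iteratedDeriv (k + 2) (eulerΦ (2 - η - k) v) z +
      mid aH (eulerSrc γ η) (eulerSrc δ η) (eulerSrc ε η) z * iteratedDeriv (k + 1) (eulerΦ (2 - η - k) v) z +
      low (eulerSrcα η) (eulerSrcβ α β η) (eulerSrcQ aH γ δ ε q η) z *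
        iteratedDeriv k (eulerΦ (2 - η - k) v) z = 0 := by
  have hκk : (2 - η - k).re < 1 := by
    have : (2 - η - (k : ℂ)).re = (2 - η).re - k := by simp
    rw [this]; linarith
  have hzI : z ∈ Ioo 1 B := ⟨hz, hzB⟩
  have hmain := heunFamily_identity (κ := 2 - η) k hF hv hbd hBb hr hρ hρre hchart hsol hz hzB hθ
  rw [sub_sub_cancel] at hmain
  have hc0 : η * (α + β - 2 + (2 - η)) - α * β = 0 := by linear_combination -hη
  rw [hc0, zero_mul, ← iteratedDeriv_eulerΦ_eq_eulerFam hv hbd hBb hr hκk (k + 2) hzI,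
    ← iteratedDeriv_eulerΦ_eq_eulerFam hv hbd hBb hr hκk (k + 1) hzI] at hmain
  have hk : eulerFam v (2 - η - k) k (2 - η - k - 1) 0 z = iteratedDeriv k (eulerΦ (2 - η - k) v) z := by
    have h := iteratedDeriv_eulerΦ_eq_eulerFam hv hbd hBb hr hκk (k + 0) hzI
    rw [Nat.add_zero] at h
    exact h.symm
  rw [hk] at hmain
  exact hmain

/-- **Corollary: `u = ∂_z^k Φ_{2−η−k}[v]` is a classical solution of the target Heun equation on
`(1,B)`,** with `u′ = ∂_z^{k+1}Φ_{2−η−k}[v]`, `u″ = ∂_z^{k+2}Φ_{2−η−k}[v]`.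
[cite: Takemura2017, Proposition 1.2] -/
theorem isSolutionOn_iteratedDeriv_eulerΦ {aH α β γ δ ε q η ρ : ℂ} {v : ℝ → ℂ} {b r B : ℝ} (k : ℕ)
    (hF : γ + δ + ε = α + β + 1) (hη : (η - α) * (η - β) = 0) (hθ : (2 - η).re < k + 1)
    (hv : ContDiffOn ℝ ((⊤ : ℕ∞) : WithTop ℕ∞) v (Ioo 1 b)) (hbd : EulerBound v r B) (hBb : B ≤ b)
    (hr : -1 < r) (hρ : ρ = 1 - δ) (hρre : -1 < ρ.re)
    (hchart : ∃ e : ℝ, 0 < e ∧ ∃ h : ℝ → ℂ, ContDiffOn ℝ ((⊤ : ℕ∞) : WithTop ℕ∞) h (Ioo (1 - e) (1 + e)) ∧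
      ∀ w ∈ Ioo 1 (1 + e), v w = ((w - 1 : ℝ) : ℂ) ^ ρ * h w)
    (hsol : ∀ w ∈ Ioo 1 B, lead aH w * iteratedDeriv 2 v w + mid aH γ δ ε w * iteratedDeriv 1 v w +
      low α β q w * v w = 0) :
    IsSolutionOn aH (eulerSrcα η) (eulerSrcβ α β η) (eulerSrc γ η) (eulerSrc δ η) (eulerSrc ε η)
      (eulerSrcQ aH γ δ ε q η) (Ioo 1 B) (iteratedDeriv k (eulerΦ (2 - η - k) v)) := by
  have hκk : (2 - η - k).re < 1 := by
    have : (2 - η - (k : ℂ)).re = (2 - η).re - k := by simp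
    rw [this]; linarith
  have hsm := contDiffOn_eulerΦ hv hbd hBb hr hκk
  refine ⟨iteratedDeriv (k + 1) (eulerΦ (2 - η - k) v), iteratedDeriv (k + 2) (eulerΦ (2 - η - k) v),
    fun z hz => ⟨?_, ?_, ?_⟩⟩
  · exact hasDerivAt_iteratedDeriv_of_contDiffOn' isOpen_Ioo hsm k hz
  · exact hasDerivAt_iteratedDeriv_of_contDiffOn' isOpen_Ioo hsm (k + 1) hz
  · exact heunOperator_iteratedDeriv_eulerΦ k hF hη hθ hv hbd hBb hr hρ hρre hchart hsol hz.1 hz.2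

end GeneralHeun

end Literature.Analysis.ODE
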